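import Literature.AlgebraicGeometry.Motives.TannakianDeligneTorusExtendedMumfordTateDirectSum
import Literature.AlgebraicGeometry.Motives.TannakianDeligneTorusMumfordTateDiagonal
import HarnessLib

/-!
# MOONEN (4.10) ∕ 1999 (1.13)–(1.14) for the EXTENDED Mumford–Tate group: `M̃T(V ⊕ V) = M̃T(V)` embedded by
# `(g, ν) ↦ (diag(g, g), ν)` — at scheme level, for the tree's `HodgeStructure.prod H H` — and, inside
# `GL(V) × GL(V) × 𝔾_m`, `M̃T(V ⊕ V)` is the diagonal `(Δ × id)(M̃T(V))`

[topic AlgebraicGeometry/Motives]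

Layer `Literature/AlgebraicGeometry/Motives`, lane `lit-hodgefound` (Track 2 foundations library — Layer A3 «Mumford–Tate
group»; prover seat `lit-hodgefound-p26`, gen 54, row g54-#3). Sequel of g51-#7 `…ExtendedMumfordTateScheme` (`extHodgeHomRat
H b = (h × Nm)^*`, `extMumfordTateIdeal`, `extMumfordTatePoints`), g50-#7 `…MumfordTateDiagonal` (`GLn.diag ∕ diagBialgHom` =
the comorphism of `Δ : g ↦ diag(g, g)`, `diag_surjective`, `hodgeHomRat_prod_self : h_{H ⊕ H}^* = h_H^* ∘ diag`, MOONEN (4.10)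
for `MT` at scheme level), g54-#1 `…ExtendedMumfordTateDirectSum` (`prodExtHodgeHomRat H H′ b b′ = (h_H^*, h_{H′}^*, Nm^*)`,
`prodExtMumfordTateIdeal H H′ b b′` = the ideal of `M̃T(H ⊕ H′)` INSIDE `GL_ι × GL_κ × 𝔾_m`), g50-#1 `…GeneratedSubgroupImage`
(**`genIdeal_comp_bialgHom`** = GGK (I.B.4)) and g53-#7 (`productMapBialgHom`). DEFINITIONS with bodies
(`GLn.diagExtBialgHom`, `extMumfordTateQuotientDiagEquiv`) + THEOREMS; no named fact (net debt `0`), no `instance`, no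
notation, no sorry.

## The sources, verbatim

B. Moonen, *An introduction to Mumford–Tate groups* (2004) [Moonen2004MT] (held text `paper:url-8e52397fca11`, p0009 L53–L54):
"(4.10) Exercise. Let `V` be a ℚ-HS, purely of some weight `m`. If `n ⩾ 1`, show that `MT(Vⁿ) = MT(V)`, where we view `MT(V)`
as a subgroup of `GL(Vⁿ)` through its diagonal action on `Vⁿ`."; p0009 L15–L21 (4.7): "Define the “big Mumford-Tate group
of `V`” to be `MT♯(V) := MT(V ⊕ ℚ(1))`. […] `MT♯(V)` may be considered as a subgroup of `MT(V) × 𝔾_m`, with surjective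
projections onto the two factors."

B. Moonen, *Notes on Mumford–Tate groups* (1999) [Moonen1999MTNotes] (held text `paper:url-c4d52097ebb3`, p0005 L18–L30):
"(1.13) […] if `V₁ = V₂` then `Hg(V)` is the diagonal subgroup of `Hg(V₁) × Hg(V₂)`; see (1.8). […] For the Mumford-Tate group
similar statements hold […] (1.14) The extended Mumford-Tate group. Another possible variant is to consider the Tannakian
subcategory `⟨V, ℚ(1)⟩^⊗ ⊂ ℚHS` generated by `V` and `ℚ(1)`. […] this `M̃T(V)` can be described as the smallest algebraic
ℚ-subgroup `M ⊂ GL(V) × 𝔾_{m,ℚ}` such that `h × Nm : 𝕊 → GL(V)_ℝ × 𝔾_{m,ℝ}` factors through `M_ℝ`."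

M. Green, P. Griffiths, M. Kerr [GreenGriffithsKerr2012], §I.B (held text p0039): "(I.B.3) `M_{ρ(φ̃)}` is the image of `M_φ̃`
under the natural map `ρ : GL(V) → GL(V_ρ)`. […] (I.B.4) `f(Ȳ^ℚ) = \overline{f(Y)}^ℚ`."; J. Carlson, S. Müller-Stach, C.
Peters [CarlsonMullerStachPeters2017], §15.1 Examples 15.1.2 (i), Remark 15.2.13; J. S. Milne [Milne2017], 2.8, 2.30, 1.41
(«closed immersion»), Cor. 1.69, 3.11.

READING (recorded — RULING 29; no named fact). `⟨V ⊕ V, ℚ(1)⟩^⊗ = ⟨V, ℚ(1)⟩^⊗`, so MOONEN's (4.10) holds for `M̃T` with the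
same words; at scheme level it is GGK (I.B.4) for `Δ × id : GL_ι × 𝔾_m → GL_{ι ⊕ ι} × 𝔾_m`, `(g, ν) ↦ (diag(g, g), ν)`, and the
point `(h × Nm)^*`: §1 **`extHodgeHomRat_prod_self : (h_{H ⊕ H} × Nm)^* = (h_H × Nm)^* ∘ (diag^* ⊗ id)`** (g50-#7 on the first
factor). §2 **`extMumfordTateIdeal_prod_self : I_{M̃T(H ⊕ H)} = (diag^* ⊗ id)^{−1}(I_{M̃T(H)})`** — `M̃T(H ⊕ H)` is the
scheme-theoretic image `(Δ × id)(M̃T(H))` —, the comorphism `diag^* ⊗ id` being SURJECTIVE (`Δ × id` is a closed immersion):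
**`extMumfordTateQuotientDiagEquiv : O(M̃T(H ⊕ H)) ≃ O(M̃T(H))`** — «`MT(Vⁿ) = MT(V)`», `n = 2`, for `M̃T`, as an ISOMORPHISM of
coordinate rings; `(T_{(inl i)(inl j)} − T_{(inr i)(inr j)}) ⊗ x ∈ I_{M̃T(H ⊕ H)}`. §3 Inside `GL_ι × GL_ι × 𝔾_m` (g54-#1): the
comorphism **`GLn.diagExtBialgHom`** of `Δ × id : GL_ι × 𝔾_m → GL_ι × GL_ι × 𝔾_m`, `a ⊗ (c ⊗ x) ↦ ac ⊗ x` (surjective), and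
**`prodExtMumfordTateIdeal_self : prodExtMumfordTateIdeal H H b b = diagExt^{*−1}(I_{M̃T(H)})`** — «if `V₁ = V₂` then [the group
of `V₁ ⊕ V₂`] is the diagonal subgroup», here of `M̃T(H) ×_{𝔾_m} M̃T(H)`: `T_ij ⊗ (1 ⊗ 1) − 1 ⊗ (T_ij ⊗ 1) ∈
prodExtMumfordTateIdeal H H b b`. §4 On `T`-points: **`productMap_comp_diag_mem_extMumfordTatePoints_iff`** (`(diag(x, x), y) ∈
M̃T(H ⊕ H)(T) ⟺ (x, y) ∈ M̃T(H)(T)`), the two diagonal blocks of every point of `M̃T(H ⊕ H)` agree, and a point `(x, x′, y)` of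
`GL_ι × GL_ι × 𝔾_m` killing `prodExtMumfordTateIdeal H H b b` has `x = x′` (**`pointMatrix_eq_of_le_ker_productMap`**). What is
NOT here: `n ⩾ 3` summands (iterate), and the Hodge-group statements (no `𝔾_m`-factor: g50-#7 §4 verbatim).

## Contents

* §0 (namespace `…Tannakian.GLn`, any `R`) `map_diag_tmul`, **`map_diag_surjective`**, `productMap_comp_map_diag` (points of `Δ ×
  id`: `(x, y) ↦ (diag(x, x), y)`), **`diagExtBialgHom`**, `diagExtBialgHom_tmul`, `diagExtBialgHom_surjective`,
  `T_tmul_one_sub_one_tmul_T_tmul_one_mem_ker_diagExtBialgHom`, `productMap_comp_diagExtBialgHom` (points: `(x, y) ↦ (x, x, y)`).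
* §1 (namespace `…Tannakian.DeligneTorus`) **`extHodgeHomRat_prod_self`**.
* §2 **`extMumfordTateIdeal_prod_self`**, `extMumfordTateIdeal_prod_self_le_comap`, `ker_map_diag_le_extMumfordTateIdeal_prod_self`,
  `T_inl_inl_tmul_sub_T_inr_inr_tmul_mem_extMumfordTateIdeal_prod_self`, **`quotientMapₐ_map_diag_injective`**,
  **`quotientMapₐ_map_diag_surjective`**, **`extMumfordTateQuotientDiagEquiv`**, `extMumfordTateQuotientDiagEquiv_mk`.
* §3 `prodExtHodgeHomRat_self_eq_comp`, **`prodExtMumfordTateIdeal_self`**, `ker_diagExtBialgHom_le_prodExtMumfordTateIdeal_self`,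
  `T_tmul_one_sub_one_tmul_T_tmul_one_mem_prodExtMumfordTateIdeal_self`.
* §4 **`productMap_comp_diag_mem_extMumfordTatePoints_iff`**, `pointMatrix_inl_inl_eq_inr_inr_of_productMap_mem_extMumfordTatePoints_prod_self`,
  **`pointMatrix_eq_of_le_ker_productMap`**, `productMap_productMap_le_ker_iff_of_self`.

## References

* [Moonen2004MT] B. Moonen, *An introduction to Mumford–Tate groups* (2004): (4.7), Exercise 4.10 (p0009).
* [Moonen1999MTNotes] B. Moonen, *Notes on Mumford–Tate groups*, CEB (1999): (1.13), (1.14) (p0005).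
* [GreenGriffithsKerr2012] M. Green, P. Griffiths, M. Kerr, *Mumford–Tate Groups and Domains* (2012): §I.B (I.B.3), (I.B.4) (p0039).
* [CarlsonMullerStachPeters2017] J. Carlson, S. Müller-Stach, C. Peters, *Period Mappings and Period Domains*, 2nd ed. (2017):
  §15.1 Examples 15.1.2 (i), Remark 15.2.13.
* [Milne2017] J. S. Milne, *Algebraic Groups*, CUP (2017): 2.8, 2.30, 1.41, Cor. 1.69, Summary 1.71, 3.11.
-/

noncomputable section

namespace Literature.AlgebraicGeometry.Motives.Tannakian

open TensorProduct WithConv Coalgebra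

universe u v w

/-! ## §0 `Δ × id` on coordinate rings: `diag^* ⊗ id : O(GL_{ι ⊕ ι}) ⊗ R[T,T⁻¹] → O(GL_ι) ⊗ R[T,T⁻¹]` and
`diagExt^* : O(GL_ι) ⊗ (O(GL_ι) ⊗ R[T,T⁻¹]) → O(GL_ι) ⊗ R[T,T⁻¹]` -/

namespace GLn

section DiagExt

variable (R : Type u) [CommRing R] (ι : Type v) [Fintype ι] [DecidableEq ι]

/-- `(diag^* ⊗ id)(a ⊗ x) = diag^*(a) ⊗ x` for the comorphism of `Δ × id : GL_ι × 𝔾_m → GL_{ι ⊕ ι} × 𝔾_m`, `(g, ν) ↦ (diag(g, g),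
ν)` (Mathlib's `Bialgebra.TensorProduct.map` of g50-#7's `diagBialgHom` and the identity). [cite: Moonen2004MT, Exercise 4.10
(«through its diagonal action on Vⁿ»); Milne2017, 2.30] -/
theorem map_diag_tmul (a : Coord R (ι ⊕ ι)) (x : LaurentPolynomial R) :
    letI := bialgebra R ι; letI := bialgebra R (ι ⊕ ι)
    Bialgebra.TensorProduct.map (diagBialgHom R ι) (BialgHom.id R (LaurentPolynomial R)) (a ⊗ₜ[R] x) = diag R ι a ⊗ₜ[R] x := by
  letI := bialgebra R ι
  letI := bialgebra R (ι ⊕ ι)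
  rw [Bialgebra.TensorProduct.map_tmul, diagBialgHom_apply, BialgHom.id_apply]

/-- **`diag^* ⊗ id` is surjective** (`Δ × id` is a closed immersion; `diag^*` is surjective, g50-#7). [cite: Milne2017, 1.41,
2.30; Moonen2004MT, Exercise 4.10] -/
theorem map_diag_surjective :
    letI := bialgebra R ι; letI := bialgebra R (ι ⊕ ι)
    Function.Surjective (Bialgebra.TensorProduct.map (diagBialgHom R ι) (BialgHom.id R (LaurentPolynomial R))) := by
  letI := bialgebra R ι
  letI := bialgebra R (ι ⊕ ι)
  intro z
  induction z using TensorProduct.induction_on with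
  | zero => exact ⟨0, map_zero _⟩
  | tmul a x =>
    obtain ⟨p, hp⟩ := diag_surjective R ι a
    exact ⟨p ⊗ₜ[R] x, by rw [map_diag_tmul, hp]⟩
  | add z₁ z₂ h₁ h₂ =>
    obtain ⟨p₁, hp₁⟩ := h₁
    obtain ⟨p₂, hp₂⟩ := h₂
    exact ⟨p₁ + p₂, by rw [map_add, hp₁, hp₂]⟩

variable {R ι} {B : Type w} [CommRing B] [Algebra R B]

/-- **On points, `Δ × id` is `(x, y) ↦ (diag(x, x), y)`**: `(x, y) ∘ (diag^* ⊗ id) = (x ∘ diag^*, y)` (and `x ∘ diag^*` has matrix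
`diag([x], [x])`, g50-#7 `pointMatrix_comp_diag`). [cite: Moonen2004MT, Exercise 4.10; Milne2017, 2.8, 2.30] -/
theorem productMap_comp_map_diag (x : Coord R ι →ₐ[R] B) (y : LaurentPolynomial R →ₐ[R] B) :
    letI := bialgebra R ι; letI := bialgebra R (ι ⊕ ι)
    (Algebra.TensorProduct.productMap x y).comp
        (Bialgebra.TensorProduct.map (diagBialgHom R ι) (BialgHom.id R (LaurentPolynomial R)) :
          Coord R (ι ⊕ ι) ⊗[R] LaurentPolynomial R →ₐ[R] Coord R ι ⊗[R] LaurentPolynomial R) =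
      Algebra.TensorProduct.productMap (x.comp (diag R ι)) y := by
  letI := bialgebra R ι
  letI := bialgebra R (ι ⊕ ι)
  refine Algebra.TensorProduct.ext' fun a z => ?_
  rw [AlgHom.comp_apply, BialgHom.coe_toAlgHom, map_diag_tmul, Algebra.TensorProduct.productMap_apply_tmul,
    Algebra.TensorProduct.productMap_apply_tmul, AlgHom.comp_apply]

variable (R ι)

/-- **The comorphism `O(GL_ι) ⊗ (O(GL_ι) ⊗ R[T,T⁻¹]) → O(GL_ι) ⊗ R[T,T⁻¹]`, `a ⊗ (c ⊗ x) ↦ ac ⊗ x`, of `Δ × id : GL_ι × 𝔾_m →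
GL_ι × GL_ι × 𝔾_m`, `(g, ν) ↦ (g, g, ν)`** — the pairing (g53-#7 `productMapBialgHom`) of `inl^* : O(GL_ι) → O(GL_ι) ⊗ R[T,T⁻¹]`
and the identity; a BIALGEBRA map. A definition with body; no instance. [cite: Moonen1999MTNotes, (1.13) («the diagonal
subgroup of Hg(V₁) × Hg(V₂)»); Milne2017, 2.30, 3.11] -/
def diagExtBialgHom :
    letI := bialgebra R ι
    Coord R ι ⊗[R] (Coord R ι ⊗[R] LaurentPolynomial R) →ₐc[R] Coord R ι ⊗[R] LaurentPolynomial R :=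
  letI := bialgebra R ι
  productMapBialgHom (R := R) (A := Coord R ι) (B := Coord R ι ⊗[R] LaurentPolynomial R)
    (D := Coord R ι ⊗[R] LaurentPolynomial R)
    (inlBialgHom R (Coord R ι) (LaurentPolynomial R)) (BialgHom.id R (Coord R ι ⊗[R] LaurentPolynomial R))

/-- `diagExt^*(a ⊗ (c ⊗ x)) = ac ⊗ x`. [cite: Moonen1999MTNotes, (1.13); Milne2017, 2.30] -/
theorem diagExtBialgHom_tmul (a c : Coord R ι) (x : LaurentPolynomial R) :
    letI := bialgebra R ι
    diagExtBialgHom R ι (a ⊗ₜ[R] (c ⊗ₜ[R] x)) = (a * c) ⊗ₜ[R] x := by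
  letI := bialgebra R ι
  rw [diagExtBialgHom, productMapBialgHom_apply, inlBialgHom_apply, BialgHom.id_apply, Algebra.TensorProduct.tmul_mul_tmul,
    one_mul]

/-- `diagExt^*` is surjective (`a ⊗ x = diagExt^*(a ⊗ (1 ⊗ x))`; `Δ × id` is a closed immersion). [cite: Milne2017, 1.41, 2.30] -/
theorem diagExtBialgHom_surjective : letI := bialgebra R ι; Function.Surjective (diagExtBialgHom R ι) := by
  letI := bialgebra R ι
  intro z
  induction z using TensorProduct.induction_on with
  | zero => exact ⟨0, map_zero _⟩
  | tmul a x => exact ⟨a ⊗ₜ[R] ((1 : Coord R ι) ⊗ₜ[R] x), by rw [diagExtBialgHom_tmul, mul_one]⟩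
  | add z₁ z₂ h₁ h₂ =>
    obtain ⟨p₁, hp₁⟩ := h₁
    obtain ⟨p₂, hp₂⟩ := h₂
    exact ⟨p₁ + p₂, by rw [map_add, hp₁, hp₂]⟩

/-- `T_ij ⊗ (1 ⊗ 1) − 1 ⊗ (T_ij ⊗ 1)` lies in the kernel of `diagExt^*` (on the diagonal the two `GL_ι`-coordinates agree).
[cite: Moonen1999MTNotes, (1.13) («the diagonal subgroup»); Milne2017, 2.8] -/
theorem T_tmul_one_sub_one_tmul_T_tmul_one_mem_ker_diagExtBialgHom (i j : ι) :
    letI := bialgebra R ι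
    T R ι i j ⊗ₜ[R] ((1 : Coord R ι) ⊗ₜ[R] (1 : LaurentPolynomial R)) -
        (1 : Coord R ι) ⊗ₜ[R] (T R ι i j ⊗ₜ[R] (1 : LaurentPolynomial R)) ∈
      RingHom.ker (diagExtBialgHom R ι) := by
  letI := bialgebra R ι
  rw [RingHom.mem_ker, map_sub, diagExtBialgHom_tmul, diagExtBialgHom_tmul, mul_one, one_mul, sub_self]

variable {R ι}

/-- **On points, `diagExt` is `(x, y) ↦ (x, x, y)`**: `(x, y) ∘ diagExt^* = (x, x, y)`. [cite: Moonen1999MTNotes, (1.13);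
Milne2017, 2.30] -/
theorem productMap_comp_diagExtBialgHom (x : Coord R ι →ₐ[R] B) (y : LaurentPolynomial R →ₐ[R] B) :
    letI := bialgebra R ι
    (Algebra.TensorProduct.productMap x y).comp
        (diagExtBialgHom R ι : Coord R ι ⊗[R] (Coord R ι ⊗[R] LaurentPolynomial R) →ₐ[R] Coord R ι ⊗[R] LaurentPolynomial R) =
      Algebra.TensorProduct.productMap x (Algebra.TensorProduct.productMap x y) := by
  letI := bialgebra R ι
  refine Algebra.TensorProduct.ext' fun a w => ?_
  induction w using TensorProduct.induction_on with
  | zero => rw [TensorProduct.tmul_zero, map_zero, map_zero]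
  | tmul c z =>
    rw [AlgHom.comp_apply, BialgHom.coe_toAlgHom, diagExtBialgHom_tmul, Algebra.TensorProduct.productMap_apply_tmul,
      Algebra.TensorProduct.productMap_apply_tmul, Algebra.TensorProduct.productMap_apply_tmul, map_mul, mul_assoc]
  | add w₁ w₂ h₁ h₂ => rw [TensorProduct.tmul_add, map_add, map_add, h₁, h₂]

end DiagExt

end GLn

namespace DeligneTorus

open HodgeStructure

variable {V : Type u} [AddCommGroup V] [Module ℚ V] {n : ℤ} {ι : Type v} [Fintype ι] [DecidableEq ι]

/-! ## §1 `(h_{H ⊕ H} × Nm)^* = (h_H × Nm)^* ∘ (diag^* ⊗ id)` -/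

/-- **`(h_{H ⊕ H} × Nm)^* = (h_H × Nm)^* ∘ (Δ × id)^*`**: the point `(h × Nm)^*` of `GL_{ι ⊕ ι} × 𝔾_m` attached to `H ⊕ H` (basis `b ⊕
b`) is `(h_H × Nm)^*` followed by `Δ × id` (g50-#7 `hodgeHomRat_prod_self` on the first factor). [cite: Moonen2004MT, Exercise
4.10 («diagonal action»), (4.7); Moonen1999MTNotes, (1.13), (1.14); CarlsonMullerStachPeters2017, §15.1 Examples 15.1.2 (i)] -/
theorem extHodgeHomRat_prod_self (H : HodgeStructure V n) (b : Module.Basis ι ℚ V) :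
    letI := GLn.bialgebra ℚ ι; letI := GLn.bialgebra ℚ (ι ⊕ ι)
    extHodgeHomRat (H.prod H) (b.prod b) =
      (extHodgeHomRat H b).comp
        (Bialgebra.TensorProduct.map (GLn.diagBialgHom ℚ ι) (BialgHom.id ℚ (LaurentPolynomial ℚ)) :
          GLn.Coord ℚ (ι ⊕ ι) ⊗[ℚ] LaurentPolynomial ℚ →ₐ[ℚ] GLn.Coord ℚ ι ⊗[ℚ] LaurentPolynomial ℚ) := by
  letI := GLn.bialgebra ℚ ι
  letI := GLn.bialgebra ℚ (ι ⊕ ι)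
  refine Algebra.TensorProduct.ext' fun a x => ?_
  rw [extHodgeHomRat_tmul, hodgeHomRat_prod_self, AlgHom.comp_apply, AlgHom.comp_apply, BialgHom.coe_toAlgHom,
    GLn.map_diag_tmul, extHodgeHomRat_tmul]

/-! ## §2 MOONEN (4.10) for `M̃T`: `M̃T(H ⊕ H) = (Δ × id)(M̃T(H))` and `O(M̃T(H ⊕ H)) ≅ O(M̃T(H))` -/

/-- **MOONEN (4.10), `n = 2`, for the extended group: `M̃T(V ⊕ V) = M̃T(V)` viewed in `GL(V ⊕ V) × 𝔾_m` through `(g, ν) ↦ (diag(g, g),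
ν)`** — the extended Mumford–Tate ideal of `H ⊕ H` (basis `b ⊕ b`) is the preimage of that of `H` under `diag^* ⊗ id`: `M̃T(H ⊕
H)` is the scheme-theoretic image `(Δ × id)(M̃T(H))` (GGK (I.B.4) with `f = Δ × id` and the point `(h × Nm)^*`). [cite: Moonen2004MT,
Exercise 4.10 («MT(Vⁿ) = MT(V), where we view MT(V) as a subgroup of GL(Vⁿ) through its diagonal action on Vⁿ»), (4.7);
Moonen1999MTNotes, (1.13), (1.14); GreenGriffithsKerr2012, §I.B (I.B.3), (I.B.4)] -/
theorem extMumfordTateIdeal_prod_self (H : HodgeStructure V n) (b : Module.Basis ι ℚ V) :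
    letI := GLn.bialgebra ℚ ι; letI := GLn.bialgebra ℚ (ι ⊕ ι)
    extMumfordTateIdeal (H.prod H) (b.prod b) =
      (extMumfordTateIdeal H b).comap
        (Bialgebra.TensorProduct.map (GLn.diagBialgHom ℚ ι) (BialgHom.id ℚ (LaurentPolynomial ℚ))) := by
  letI := GLn.hopfAlgebra ℚ ι
  letI := GLn.hopfAlgebra ℚ (ι ⊕ ι)
  have h1 := genIdeal_comp_bialgHom (k := ℚ) (A := GLn.Coord ℚ (ι ⊕ ι) ⊗[ℚ] LaurentPolynomial ℚ)
    (B := GLn.Coord ℚ ι ⊗[ℚ] LaurentPolynomial ℚ) (C := Coord ℂ)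
    (Bialgebra.TensorProduct.map (GLn.diagBialgHom ℚ ι) (BialgHom.id ℚ (LaurentPolynomial ℚ)))
    fun _ : Unit => extHodgeHomRat H b
  rw [extMumfordTateIdeal_eq_genIdeal, extMumfordTateIdeal_eq_genIdeal, ← h1]
  exact congrArg (genIdeal ℚ) (funext fun _ => extHodgeHomRat_prod_self H b)

/-- `I_{M̃T(H ⊕ H)} ≤ (diag^* ⊗ id)^{−1}(I_{M̃T(H)})` along the algebra map (for the quotient map). [cite: Moonen2004MT, Exercise
4.10] -/
theorem extMumfordTateIdeal_prod_self_le_comap (H : HodgeStructure V n) (b : Module.Basis ι ℚ V) :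
    letI := GLn.bialgebra ℚ ι; letI := GLn.bialgebra ℚ (ι ⊕ ι)
    extMumfordTateIdeal (H.prod H) (b.prod b) ≤ (extMumfordTateIdeal H b).comap
      (Bialgebra.TensorProduct.map (GLn.diagBialgHom ℚ ι) (BialgHom.id ℚ (LaurentPolynomial ℚ)) :
        GLn.Coord ℚ (ι ⊕ ι) ⊗[ℚ] LaurentPolynomial ℚ →ₐ[ℚ] GLn.Coord ℚ ι ⊗[ℚ] LaurentPolynomial ℚ) :=
  fun a ha => by
    rw [extMumfordTateIdeal_prod_self H b] at ha
    exact ha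

/-- The ideal of `(Δ × id)(GL_ι × 𝔾_m) ⊂ GL_{ι ⊕ ι} × 𝔾_m` (the kernel of `diag^* ⊗ id`) lies in the extended Mumford–Tate ideal
of `H ⊕ H`: `M̃T(H ⊕ H) ⊂ (Δ × id)(GL(V) × 𝔾_m)`. [cite: Moonen2004MT, Exercise 4.10; Moonen1999MTNotes, (1.13) («the diagonal
subgroup»)] -/
theorem ker_map_diag_le_extMumfordTateIdeal_prod_self (H : HodgeStructure V n) (b : Module.Basis ι ℚ V) :
    letI := GLn.bialgebra ℚ ι; letI := GLn.bialgebra ℚ (ι ⊕ ι)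
    RingHom.ker (Bialgebra.TensorProduct.map (GLn.diagBialgHom ℚ ι) (BialgHom.id ℚ (LaurentPolynomial ℚ))) ≤
      extMumfordTateIdeal (H.prod H) (b.prod b) := by
  rw [extMumfordTateIdeal_prod_self]
  exact Ideal.comap_mono bot_le

/-- In particular `(T_{(inl i)(inl j)} − T_{(inr i)(inr j)}) ⊗ x ∈ I_{M̃T(H ⊕ H)}`: on every point of `M̃T(H ⊕ H)` the two diagonal
blocks of the first component agree. [cite: Moonen2004MT, Exercise 4.10; Moonen1999MTNotes, (1.13)] -/
theorem T_inl_inl_tmul_sub_T_inr_inr_tmul_mem_extMumfordTateIdeal_prod_self (H : HodgeStructure V n)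
    (b : Module.Basis ι ℚ V) (i j : ι) (x : LaurentPolynomial ℚ) :
    GLn.T ℚ (ι ⊕ ι) (Sum.inl i) (Sum.inl j) ⊗ₜ[ℚ] x - GLn.T ℚ (ι ⊕ ι) (Sum.inr i) (Sum.inr j) ⊗ₜ[ℚ] x ∈
      extMumfordTateIdeal (H.prod H) (b.prod b) :=
  ker_map_diag_le_extMumfordTateIdeal_prod_self H b (by
    rw [RingHom.mem_ker, map_sub, GLn.map_diag_tmul, GLn.map_diag_tmul, GLn.diag_T_inl_inl, GLn.diag_T_inr_inr, sub_self])

/-- **`Δ × id : M̃T(H) → M̃T(H ⊕ H)` is dominant**: `O(GL_{ι ⊕ ι} × 𝔾_m)/I_{M̃T(H ⊕ H)} → O(GL_ι × 𝔾_m)/I_{M̃T(H)}` is injective.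
[cite: Moonen2004MT, Exercise 4.10; GreenGriffithsKerr2012, §I.B (I.B.3); Milne2017, Cor. 1.69] -/
theorem quotientMapₐ_map_diag_injective (H : HodgeStructure V n) (b : Module.Basis ι ℚ V) :
    letI := GLn.bialgebra ℚ ι; letI := GLn.bialgebra ℚ (ι ⊕ ι)
    Function.Injective (Ideal.quotientMapₐ (extMumfordTateIdeal H b)
      (Bialgebra.TensorProduct.map (GLn.diagBialgHom ℚ ι) (BialgHom.id ℚ (LaurentPolynomial ℚ)) :
        GLn.Coord ℚ (ι ⊕ ι) ⊗[ℚ] LaurentPolynomial ℚ →ₐ[ℚ] GLn.Coord ℚ ι ⊗[ℚ] LaurentPolynomial ℚ)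
      (extMumfordTateIdeal_prod_self_le_comap H b)) := by
  refine (injective_iff_map_eq_zero _).2 fun a ha => ?_
  obtain ⟨a, rfl⟩ := Ideal.Quotient.mk_surjective a
  rw [Ideal.quotient_map_mkₐ, Ideal.Quotient.mkₐ_eq_mk, Ideal.Quotient.eq_zero_iff_mem] at ha
  rw [Ideal.Quotient.eq_zero_iff_mem, extMumfordTateIdeal_prod_self H b]
  exact ha

/-- … and surjective (`diag^* ⊗ id` is surjective: `Δ × id` is a closed immersion). [cite: Moonen2004MT, Exercise 4.10; Milne2017,
1.41] -/
theorem quotientMapₐ_map_diag_surjective (H : HodgeStructure V n) (b : Module.Basis ι ℚ V) :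
    letI := GLn.bialgebra ℚ ι; letI := GLn.bialgebra ℚ (ι ⊕ ι)
    Function.Surjective (Ideal.quotientMapₐ (extMumfordTateIdeal H b)
      (Bialgebra.TensorProduct.map (GLn.diagBialgHom ℚ ι) (BialgHom.id ℚ (LaurentPolynomial ℚ)) :
        GLn.Coord ℚ (ι ⊕ ι) ⊗[ℚ] LaurentPolynomial ℚ →ₐ[ℚ] GLn.Coord ℚ ι ⊗[ℚ] LaurentPolynomial ℚ)
      (extMumfordTateIdeal_prod_self_le_comap H b)) := by
  letI := GLn.bialgebra ℚ ι
  letI := GLn.bialgebra ℚ (ι ⊕ ι)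
  intro y
  obtain ⟨y, rfl⟩ := Ideal.Quotient.mk_surjective y
  obtain ⟨x, rfl⟩ := GLn.map_diag_surjective ℚ ι y
  exact ⟨Ideal.Quotient.mk _ x, by rw [Ideal.quotient_map_mkₐ, Ideal.Quotient.mkₐ_eq_mk]; rfl⟩

/-- **MOONEN (4.10), `n = 2`, for `M̃T`: `O(M̃T(H ⊕ H)) ≅ O(M̃T(H))` — `Δ × id` is an ISOMORPHISM of `ℚ`-group schemes `M̃T(H) ⥲ M̃T(H
⊕ H)`** (closed immersion + dominant): the algebra isomorphism of coordinate rings induced by `diag^* ⊗ id`. A definition with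
body. [cite: Moonen2004MT, Exercise 4.10 («MT(Vⁿ) = MT(V)»), (4.7); Moonen1999MTNotes, (1.13), (1.14)] -/
def extMumfordTateQuotientDiagEquiv (H : HodgeStructure V n) (b : Module.Basis ι ℚ V) :
    (GLn.Coord ℚ (ι ⊕ ι) ⊗[ℚ] LaurentPolynomial ℚ ⧸ extMumfordTateIdeal (H.prod H) (b.prod b)) ≃ₐ[ℚ]
      GLn.Coord ℚ ι ⊗[ℚ] LaurentPolynomial ℚ ⧸ extMumfordTateIdeal H b :=
  letI := GLn.bialgebra ℚ ι
  letI := GLn.bialgebra ℚ (ι ⊕ ι)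
  AlgEquiv.ofBijective
    (Ideal.quotientMapₐ (extMumfordTateIdeal H b)
      (Bialgebra.TensorProduct.map (GLn.diagBialgHom ℚ ι) (BialgHom.id ℚ (LaurentPolynomial ℚ)) :
        GLn.Coord ℚ (ι ⊕ ι) ⊗[ℚ] LaurentPolynomial ℚ →ₐ[ℚ] GLn.Coord ℚ ι ⊗[ℚ] LaurentPolynomial ℚ)
      (extMumfordTateIdeal_prod_self_le_comap H b))
    ⟨quotientMapₐ_map_diag_injective H b, quotientMapₐ_map_diag_surjective H b⟩

/-- The isomorphism on classes: `[a ⊗ x] ↦ [diag^*(a) ⊗ x]`. [cite: Moonen2004MT, Exercise 4.10] -/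
theorem extMumfordTateQuotientDiagEquiv_mk (H : HodgeStructure V n) (b : Module.Basis ι ℚ V) (a : GLn.Coord ℚ (ι ⊕ ι))
    (x : LaurentPolynomial ℚ) :
    extMumfordTateQuotientDiagEquiv H b (Ideal.Quotient.mk _ (a ⊗ₜ[ℚ] x)) = Ideal.Quotient.mk _ (GLn.diag ℚ ι a ⊗ₜ[ℚ] x) := by
  letI := GLn.bialgebra ℚ ι
  letI := GLn.bialgebra ℚ (ι ⊕ ι)
  rw [extMumfordTateQuotientDiagEquiv, AlgEquiv.ofBijective_apply, Ideal.quotient_map_mkₐ, Ideal.Quotient.mkₐ_eq_mk,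
    ← GLn.map_diag_tmul]
  rfl

/-! ## §3 Inside `GL_ι × GL_ι × 𝔾_m`: `M̃T(H ⊕ H)` is the diagonal `(Δ × id)(M̃T(H))` of `M̃T(H) ×_{𝔾_m} M̃T(H)` -/

/-- `(h_H^*, h_H^*, Nm^*) = (h_H × Nm)^* ∘ diagExt^*`. [cite: Moonen1999MTNotes, (1.13), (1.14); Milne2017, 2.30] -/
theorem prodExtHodgeHomRat_self_eq_comp (H : HodgeStructure V n) (b : Module.Basis ι ℚ V) :
    letI := GLn.bialgebra ℚ ι
    prodExtHodgeHomRat H H b b =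
      (extHodgeHomRat H b).comp (GLn.diagExtBialgHom ℚ ι :
        GLn.Coord ℚ ι ⊗[ℚ] (GLn.Coord ℚ ι ⊗[ℚ] LaurentPolynomial ℚ) →ₐ[ℚ] GLn.Coord ℚ ι ⊗[ℚ] LaurentPolynomial ℚ) := by
  letI := GLn.bialgebra ℚ ι
  refine Algebra.TensorProduct.ext' fun a w => ?_
  induction w using TensorProduct.induction_on with
  | zero => rw [TensorProduct.tmul_zero, map_zero, map_zero]
  | tmul c x =>
    rw [prodExtHodgeHomRat_tmul, AlgHom.comp_apply, BialgHom.coe_toAlgHom, GLn.diagExtBialgHom_tmul, extHodgeHomRat_tmul,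
      map_mul, mul_assoc]
  | add w₁ w₂ h₁ h₂ => rw [TensorProduct.tmul_add, map_add, map_add, h₁, h₂]

/-- **«if `V₁ = V₂` then [the group of `V₁ ⊕ V₂`] is the diagonal subgroup», for `M̃T` inside `GL_ι × GL_ι × 𝔾_m`**: g54-#1's
`prodExtMumfordTateIdeal H H b b` (the ideal of `M̃T(H ⊕ H) ⊂ GL_ι × GL_ι × 𝔾_m`) is the preimage of `I_{M̃T(H)}` under
`diagExt^*` — `M̃T(H ⊕ H) = (Δ × id)(M̃T(H))`, the diagonal of the fibre product `M̃T(H) ×_{𝔾_m} M̃T(H)` (GGK (I.B.4) with `f = Δ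
× id`, `Y = (h × Nm)(𝕊)`). [cite: Moonen1999MTNotes, (1.13) («if V₁ = V₂ then Hg(V) is the diagonal subgroup of Hg(V₁) × Hg(V₂)»
— «For the Mumford-Tate group similar statements hold»), (1.14); Moonen2004MT, Exercise 4.10; GreenGriffithsKerr2012, §I.B
(I.B.4)] -/
theorem prodExtMumfordTateIdeal_self (H : HodgeStructure V n) (b : Module.Basis ι ℚ V) :
    letI := GLn.bialgebra ℚ ι
    prodExtMumfordTateIdeal H H b b = (extMumfordTateIdeal H b).comap (GLn.diagExtBialgHom ℚ ι) := by
  letI := GLn.hopfAlgebra ℚ ι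
  have h1 := genIdeal_comp_bialgHom (k := ℚ) (A := GLn.Coord ℚ ι ⊗[ℚ] (GLn.Coord ℚ ι ⊗[ℚ] LaurentPolynomial ℚ))
    (B := GLn.Coord ℚ ι ⊗[ℚ] LaurentPolynomial ℚ) (C := Coord ℂ) (GLn.diagExtBialgHom ℚ ι)
    fun _ : Unit => extHodgeHomRat H b
  rw [prodExtMumfordTateIdeal_eq_genIdeal, extMumfordTateIdeal_eq_genIdeal, ← h1]
  exact congrArg (genIdeal (A := GLn.Coord ℚ ι ⊗[ℚ] (GLn.Coord ℚ ι ⊗[ℚ] LaurentPolynomial ℚ)) ℚ)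
    (funext fun _ => prodExtHodgeHomRat_self_eq_comp H b)

/-- The ideal of the diagonal `(Δ × id)(GL_ι × 𝔾_m) ⊂ GL_ι × GL_ι × 𝔾_m` (the kernel of `diagExt^*`) lies in
`prodExtMumfordTateIdeal H H b b`. [cite: Moonen1999MTNotes, (1.13); Moonen2004MT, Exercise 4.10] -/
theorem ker_diagExtBialgHom_le_prodExtMumfordTateIdeal_self (H : HodgeStructure V n) (b : Module.Basis ι ℚ V) :
    letI := GLn.bialgebra ℚ ι
    RingHom.ker (GLn.diagExtBialgHom ℚ ι) ≤ prodExtMumfordTateIdeal H H b b := by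
  rw [prodExtMumfordTateIdeal_self]
  exact Ideal.comap_mono bot_le

/-- In particular `T_ij ⊗ (1 ⊗ 1) − 1 ⊗ (T_ij ⊗ 1) ∈ prodExtMumfordTateIdeal H H b b`: on every point `(x, x′, y)` of `M̃T(H ⊕ H) ⊂
GL_ι × GL_ι × 𝔾_m` the two `GL_ι`-components agree. [cite: Moonen1999MTNotes, (1.13) («the diagonal subgroup»); Moonen2004MT,
Exercise 4.10] -/
theorem T_tmul_one_sub_one_tmul_T_tmul_one_mem_prodExtMumfordTateIdeal_self (H : HodgeStructure V n)
    (b : Module.Basis ι ℚ V) (i j : ι) :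
    GLn.T ℚ ι i j ⊗ₜ[ℚ] ((1 : GLn.Coord ℚ ι) ⊗ₜ[ℚ] (1 : LaurentPolynomial ℚ)) -
        (1 : GLn.Coord ℚ ι) ⊗ₜ[ℚ] (GLn.T ℚ ι i j ⊗ₜ[ℚ] (1 : LaurentPolynomial ℚ)) ∈
      prodExtMumfordTateIdeal H H b b :=
  ker_diagExtBialgHom_le_prodExtMumfordTateIdeal_self H b
    (GLn.T_tmul_one_sub_one_tmul_T_tmul_one_mem_ker_diagExtBialgHom ℚ ι i j)

/-! ## §4 On `T`-points: `M̃T(H ⊕ H)(T) = {(diag(x, x), y) | (x, y) ∈ M̃T(H)(T)}` -/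

variable {T : Type w} [CommRing T] [Algebra ℚ T]

/-- **`(x, y) ∈ M̃T(H)(T) ⟺ (diag(x, x), y) ∈ M̃T(H ⊕ H)(T)`** (`diag^* ⊗ id` is surjective). [cite: Moonen2004MT, Exercise 4.10
(«through its diagonal action»); Moonen1999MTNotes, (1.13), (1.14)] -/
theorem productMap_comp_diag_mem_extMumfordTatePoints_iff (H : HodgeStructure V n) (b : Module.Basis ι ℚ V)
    (x : GLn.Coord ℚ ι →ₐ[ℚ] T) (y : LaurentPolynomial ℚ →ₐ[ℚ] T) :
    letI := GLn.bialgebra ℚ ι; letI := GLn.bialgebra ℚ (ι ⊕ ι)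
    toConv (Algebra.TensorProduct.productMap (x.comp (GLn.diag ℚ ι)) y) ∈ extMumfordTatePoints (H.prod H) (b.prod b) T ↔
      toConv (Algebra.TensorProduct.productMap x y) ∈ extMumfordTatePoints H b T := by
  letI := GLn.bialgebra ℚ ι
  letI := GLn.bialgebra ℚ (ι ⊕ ι)
  rw [productMap_mem_extMumfordTatePoints_iff, productMap_mem_extMumfordTatePoints_iff, ← GLn.productMap_comp_map_diag,
    extMumfordTateIdeal_prod_self]
  have h : RingHom.ker ((Algebra.TensorProduct.productMap x y).comp
      (Bialgebra.TensorProduct.map (GLn.diagBialgHom ℚ ι) (BialgHom.id ℚ (LaurentPolynomial ℚ)) :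
        GLn.Coord ℚ (ι ⊕ ι) ⊗[ℚ] LaurentPolynomial ℚ →ₐ[ℚ] GLn.Coord ℚ ι ⊗[ℚ] LaurentPolynomial ℚ)) =
      (RingHom.ker (Algebra.TensorProduct.productMap x y)).comap
        (Bialgebra.TensorProduct.map (GLn.diagBialgHom ℚ ι) (BialgHom.id ℚ (LaurentPolynomial ℚ))) :=
    Ideal.ext fun _ => Iff.rfl
  rw [h]
  exact Ideal.comap_le_comap_iff_of_surjective _ (GLn.map_diag_surjective ℚ ι) _ _

/-- **Every point of `M̃T(H ⊕ H)(T)` is of the form `(diag(x, x), y)`**: for `(g, y) ∈ M̃T(H ⊕ H)(T)` the two diagonal blocks of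
`[g]` agree (and the off-diagonal blocks vanish, g54-#1). [cite: Moonen2004MT, Exercise 4.10; Moonen1999MTNotes, (1.13) («the
diagonal subgroup»)] -/
theorem pointMatrix_inl_inl_eq_inr_inr_of_productMap_mem_extMumfordTatePoints_prod_self (H : HodgeStructure V n)
    (b : Module.Basis ι ℚ V) {g : GLn.Coord ℚ (ι ⊕ ι) →ₐ[ℚ] T} {y : LaurentPolynomial ℚ →ₐ[ℚ] T}
    (h : letI := GLn.bialgebra ℚ (ι ⊕ ι)
      toConv (Algebra.TensorProduct.productMap g y) ∈ extMumfordTatePoints (H.prod H) (b.prod b) T) (i j : ι) :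
    GLn.pointMatrix g (Sum.inl i) (Sum.inl j) = GLn.pointMatrix g (Sum.inr i) (Sum.inr j) := by
  have h1 := RingHom.mem_ker.1 (h (T_inl_inl_tmul_sub_T_inr_inr_tmul_mem_extMumfordTateIdeal_prod_self H b i j 1))
  rw [WithConv.ofConv_toConv, map_sub, Algebra.TensorProduct.productMap_apply_tmul, Algebra.TensorProduct.productMap_apply_tmul,
    map_one, mul_one, mul_one, sub_eq_zero] at h1
  exact h1

/-- **A point `(x, x′, y)` of `GL_ι × GL_ι × 𝔾_m` in `M̃T(H ⊕ H)` (it kills `prodExtMumfordTateIdeal H H b b`) has `x = x′`** — the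
diagonal. [cite: Moonen1999MTNotes, (1.13) («if V₁ = V₂ then … the diagonal subgroup»); Moonen2004MT, Exercise 4.10] -/
theorem pointMatrix_eq_of_le_ker_productMap (H : HodgeStructure V n) (b : Module.Basis ι ℚ V)
    {x x' : GLn.Coord ℚ ι →ₐ[ℚ] T} {y : LaurentPolynomial ℚ →ₐ[ℚ] T}
    (h : prodExtMumfordTateIdeal H H b b ≤
      RingHom.ker (Algebra.TensorProduct.productMap x (Algebra.TensorProduct.productMap x' y))) :
    GLn.pointMatrix x = GLn.pointMatrix x' := by
  ext i j
  have h1 := RingHom.mem_ker.1 (h (T_tmul_one_sub_one_tmul_T_tmul_one_mem_prodExtMumfordTateIdeal_self H b i j))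
  rw [map_sub, Algebra.TensorProduct.productMap_apply_tmul, Algebra.TensorProduct.productMap_apply_tmul,
    Algebra.TensorProduct.productMap_apply_tmul, Algebra.TensorProduct.productMap_apply_tmul, map_one, map_one, map_one,
    mul_one, mul_one, mul_one, one_mul, sub_eq_zero] at h1
  rw [GLn.pointMatrix_apply, GLn.pointMatrix_apply]
  exact h1

/-- **`(x, x′, y) ∈ M̃T(H ⊕ H) ⊂ GL_ι × GL_ι × 𝔾_m` iff `x = x′` and `(x, y) ∈ M̃T(H)(T)`** (`diagExt^*` is surjective with kernel
in the ideal). [cite: Moonen1999MTNotes, (1.13), (1.14); Moonen2004MT, Exercise 4.10] -/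
theorem productMap_productMap_le_ker_iff_of_self (H : HodgeStructure V n) (b : Module.Basis ι ℚ V)
    (x : GLn.Coord ℚ ι →ₐ[ℚ] T) (y : LaurentPolynomial ℚ →ₐ[ℚ] T) :
    letI := GLn.bialgebra ℚ ι
    prodExtMumfordTateIdeal H H b b ≤
        RingHom.ker (Algebra.TensorProduct.productMap x (Algebra.TensorProduct.productMap x y)) ↔
      toConv (Algebra.TensorProduct.productMap x y) ∈ extMumfordTatePoints H b T := by
  letI := GLn.bialgebra ℚ ι
  rw [productMap_mem_extMumfordTatePoints_iff, ← GLn.productMap_comp_diagExtBialgHom, prodExtMumfordTateIdeal_self]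
  have h : RingHom.ker ((Algebra.TensorProduct.productMap x y).comp
      (GLn.diagExtBialgHom ℚ ι :
        GLn.Coord ℚ ι ⊗[ℚ] (GLn.Coord ℚ ι ⊗[ℚ] LaurentPolynomial ℚ) →ₐ[ℚ] GLn.Coord ℚ ι ⊗[ℚ] LaurentPolynomial ℚ)) =
      (RingHom.ker (Algebra.TensorProduct.productMap x y)).comap (GLn.diagExtBialgHom ℚ ι) :=
    Ideal.ext fun _ => Iff.rfl
  rw [h]
  exact Ideal.comap_le_comap_iff_of_surjective _ (GLn.diagExtBialgHom_surjective ℚ ι) _ _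

end DeligneTorus

end Literature.AlgebraicGeometry.Motives.Tannakian
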